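import Summits.QuantumFields.BalabanUV.T4Continuum.Spine.NE1p.DressedSmallFieldSlotLettersWitnessMu
import Literature.Probability.LatticeModels.PolymerPressureAnalytic

/-!
# T⁴ programme, spine estimate NE1′ (node O3b/H2) — WITNESS W⟨next⟩ (follower of W58 ∕ W73 ∕ W80 on the same datum): THE ENDs' BOUNDED
# QUANTITY IN CLOSED FORM — on W58's datum the dressed small-field output at the one cube along the REAL source pencil IS
# `E[actSW (0 + s • wW)]({0}) = s·sW` EXACTLY (the activity is REAL, the Kotecký–Preiss logarithm is then the real logarithm of the
# positive one-polymer partition function `1 + (e^{s·sW} − 1) = e^{s·sW}` — Literature `polymerLogZ_eq_log_of_real` ONCE), so the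
# attached part bounded by W58 P2 §5 (`≤ 2·K₀(64,8)`), by W73 at `sμ = 1` (`≤ K₀(64,8)`) and by W80 (`≤ 4∕3·K₀(64,8)`) EQUALS `sW = A∕64`;
# the located slack of OUR constants on OUR toy: `2·K₀(64,8) = 73728·e·K₀(64,8)²·sW` with `K₀(64,8) = 162⁶⁴∕81`

Cell `pub-balaban`, sub-cell `t4`, row NE1′ formalisation crew (`t4/formal/NE1p/LEAVES.md` row W⟨next⟩ — own-initiative follower of W73
`DressedSmallFieldSlotLettersWitnessMu` (p239626) ∕ W80 `…Sharp` (p240382) on W58's datum; INTENT `CLAIMS.log` l.⟨this gen⟩), unit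
`b2b-balaban-t4-ne1p-formalise-leaf-04` (LEAF PROVER 04, gen 16).  ADDITIVE — imports W73 `Spine/NE1p/DressedSmallFieldSlotLettersWitnessMu`
(⇒ W58 P1∕P2∕P3: `actSW`, `termsW`, `wW`, `sW`, `rW`, `Acst`, `actSW_pencil_closed`, `slotLettersEnd_fires_torus_closed`,
`slotLettersMuEnd_at_one`; W24 `X₀`∕`eq_X₀_iff`; pv22's torus) and Literature `Probability/LatticeModels/PolymerPressureAnalytic`
(`polymerLogZ_eq_log_of_real` — [folklore] in a cite-tagged Kotecký–Preiss module; FIRST use in `Spine/NE1p`) ONLY — both LANDED;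
THEOREMS ONLY (0 def, 0 `def … : Prop`, 0 cite, 0 sorry); nothing restated — used BY NAME.

WHAT.
* §23 `termsW_of_ne` ∕ `actSW_of_ne` (off `X₀` the slot activity is the EMPTY sum), **`actSW_pencil_real`** — along the REAL source pencil
  `0 + (s : ℂ) • wW` the dressed slot activity is REAL on every torus polymer (`e^{s·sW} − 1` at `X₀` by W73 `actSW_pencil_closed`, `0` elsewhere).
* §24 `Z_cube_pencil` — the one-polymer partition function along the Kotecký–Preiss ray: `Z(t·actSW)({X₀}) = 1 + t·(e^{s·sW} − 1)`
  (`polymerPartitionFunction_insert` on the singleton, as W24's `Z_cube_eq` — re-derived in this file's instance context, see NOTE);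
  `Z_ray_ne_zero` — it is POSITIVE for `t ∈ [0, 1]` (a convex combination of `1` and `e^{s·sW} > 0`).
* §25 **`locE_pencil_real_closed (s : ℝ) : E[actSW D N (0 + (s:ℂ) • wW D)]({0}) = s·sW`** — W24 `locE_cube_eq` (the cube's output IS
  the KP logarithm of the singleton system) ∘ Literature `polymerLogZ_eq_log_of_real` (REAL activities, zero-free ray ⇒ `log Z = Real.log (Re Z)`)
  ∘ `Real.log (e^{s·sW}) = s·sW`; **`attachedPart_exact`**: `E[actSW (0 + wW)]({0}) − E[actSW 0]({0}) = sW` and its norm `= sW`;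
  `muPart_real_exact (t : ℝ)`: along the real source pencil the μ-part's quantity is `t·sW`.
* §26 LOCATED SLACK (OUR constants on OUR toy — an observation, not a defect of any END): `sW_closed` (`sW = (36864·e·K₀(64,8))⁻¹`,
  from `rW = 32∕A`, `A = (e·K₀(64,8)·9·64)⁻¹`), `K₀_closed` (`K₀(64,8) = 162⁶⁴∕81`, pv22's `kappa₀_four` BY NAME), **`slack_attachedEnd`**
  (`2·K₀(64,8) = (73728·e·K₀(64,8)²)·sW`: W58 P2 §5's closed bound is `73728·e·K₀²` times the bounded quantity), `slack_muEnd_at_one`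
  (`K₀ = 36864·e·K₀²·sW`, W73), `slack_sharpEnd` (`4∕3·K₀ = 49152·e·K₀²·sW`, W80); `attachedEnd_not_tight` (`sW < 2·K₀(64,8)` strictly).

NOTE (instances; typer R-T123 (vii) ∕ owner F-ne1pp1-g31-1).  `TDom 4 N` is a `def` subtype: in W24's cone `DecidableEq (TDom 4 N)` ∕
`DecidableRel TTouch` are the classical instances, in this file's cone (the substrate's carriers imported through W58) the global
`instDecidableEqTDom` is found.  The `locE` statements are `Dom`-PINNED as in W58 P2∕W73 (so W24's `locE_cube_eq` applies by type ascription);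
the ONE junction between W24's `polymerLogZ` term and the Literature lemma's is made by `convert` (Decidable instances are subsingletons) —
no `attribute` is touched, nothing is re-declared.

HONEST FRAMING.  A DECIDED TOY ([folklore]; 0 sorry; 0 citations; no `def`): a closed-form evaluation of the crew's END quantity on OUR
1×1 Gaussian datum along the REAL source pencil (complex `s`: W73's «iff» only — the KP logarithm of a non-real activity is not claimed in
closed form); the slack figures compare OUR closed constants (`2·K₀`, `K₀`, `4∕3·K₀`, located by pv22's `K₀_four`∕`kappa₀_four` at `162⁶⁴∕81`)
with OUR toy's exact value `sW` — they say NOTHING about the sharpness of Bałaban's (2.38)∕(2.41) or of the ENDs on Bałaban's densities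
(a one-cube toy with a prepaid table is the least demanding datum the ENDs admit); no numeral of [Balaban1988RGII] is asserted; (B1b) by
definition of the toy; (B3) met BY CHOICE of `rW` — G-ne9p2-5 UNPRINTED; 0 binders instantiated on Bałaban's densities; no wall item; the
NE1′ wall (wording v1.8, T4-DAG v48∕v49; kind v1.7) does NOT move; R-t4r2-Q2 NOT met thereby; NE1′ ⇐ the named binders — NOT proved, NOT
printed; spine PROVED 0∕9; count 9 unchanged.  Rung (B)+1 on ONE finite four-torus — NOT infinite volume, NOT a mass gap, NOT OS on ℝ⁴,
NOT Clay.  HONEST DEPENDENCY: continuum YM on T⁴ ⇐ BetaPertH ∧ nine spine estimates (0/9 proved); BetaPertH ⇐ (D1) ∧ (D4) ∧ CAP+tail;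
G-an2-4 gates asym, D1 and NE2/3/4.
-/

noncomputable section

namespace Summit.QuantumFields.BalabanUV.T4Continuum.NE1p.DressedSmallFieldSlotLettersWitnessExact

open Set Metric MeasureTheory Complex
open scoped BigOperators
open Literature.MathematicalPhysics.QuantumFieldTheory.Balaban1983to89
open Literature.MathematicalPhysics.QuantumFieldTheory.Balaban1983to89.B12TreeDecay (K₀ K₀_pos kappa₀)
open Literature.MathematicalPhysics.QuantumFieldTheory.Balaban1983to89.B13Resummation (locE)
open Literature.MathematicalPhysics.QuantumFieldTheory.Balaban1983to89.TreeLengthTorus (TDom tsys torusTreeLen)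
open Literature.MathematicalPhysics.QuantumFieldTheory.Balaban1983to89.TreeLengthTorusGeometry (tgeometry TTouch ttouch_symm)
open Literature.MathematicalPhysics.QuantumFieldTheory.Balaban1983to89.TreeLengthCubeSystem (kappa₀_four)
open Literature.Probability.LatticeModels (polymerLogZ polymerPartitionFunction polymerPartitionFunction_insert polymerLogZ_eq_log_of_real)
open Summit.QuantumFields.BalabanUV.T4Continuum.B13HistMeasurable (B13HistM)
open Summit.QuantumFields.BalabanUV.T4Continuum.SubstrateTwoRunsDriven (DrivenRuns)
open Summit.QuantumFields.BalabanUV.T4Continuum.NE1p.DressedSmallFieldCoresWitness (Acst Acst_pos)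
open Summit.QuantumFields.BalabanUV.T4Continuum.NE1p.DressedSmallFieldTorusWitness (X₀ X₀_val eq_X₀_iff locE_cube_eq prefactor_pos)
open Summit.QuantumFields.BalabanUV.T4Continuum.NE1p.DressedSmallFieldSlotLettersWitness
open Summit.QuantumFields.BalabanUV.T4Continuum.NE1p.DressedSmallFieldSlotLettersWitnessEnd
open Summit.QuantumFields.BalabanUV.T4Continuum.NE1p.DressedSmallFieldSlotLettersWitnessMu

variable {G : Type} [GaugeGroup G] (D : DrivenRuns G) (N : ℕ) [NeZero N]

/-! ## §23 The dressed slot activity along the REAL source pencil is REAL on every polymer -/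

/-- Off the cube `X₀` the residue is EMPTY. [folklore] -/
theorem termsW_of_ne {Z : TDom 4 N} (h : Z.1 ≠ {0}) : (termsW D) N Z = ∅ := by
  unfold termsW; rw [if_neg h]

/-- … so the summed slot activity VANISHES there, at every table. [folklore] -/
theorem actSW_of_ne {Z : TDom 4 N} (h : Z.1 ≠ {0}) (y : B13HistM (PW D)) : (actSW D) N y Z = 0 := by
  unfold actSW; rw [termsW_of_ne D N h, Finset.sum_empty]

/-- **THE DRESSED SLOT ACTIVITY ALONG THE REAL SOURCE PENCIL IS REAL**: `Im (actSW D N (0 + (s:ℂ) • wW D) Z) = 0` for every torus polymer `Z`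
(`e^{s·sW} − 1` at `X₀` by W73's `actSW_pencil_closed`; `0` elsewhere). [folklore] -/
theorem actSW_pencil_real (s : ℝ) : ∀ Z : TDom 4 N, ((actSW D) N ((0 : B13HistM (PW D)) + (s : ℂ) • (wW D)) Z).im = 0 := by
  intro Z
  by_cases h : Z.1 = {0}
  · rw [(eq_X₀_iff N Z).1 h, actSW_pencil_closed, show (s : ℂ) * (sW : ℂ) = ((s * sW : ℝ) : ℂ) by push_cast; ring,
      ← Complex.ofReal_exp, ← Complex.ofReal_one, ← Complex.ofReal_sub, Complex.ofReal_im]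
  · rw [actSW_of_ne D N h, Complex.zero_im]

/-! ## §24 The one-polymer partition function along the Kotecký–Preiss ray is POSITIVE -/

open Classical in
/-- THE ONE-POLYMER PARTITION FUNCTION ALONG THE RAY: `Z(t·actSW(0 + s•wW))({X₀}) = 1 + t·(e^{s·sW} − 1)` (one-polymer recursion on the
singleton — W24's `Z_cube_eq`, re-derived in this file's instance context). [folklore] -/
theorem Z_cube_pencil (s : ℝ) (t : ℂ) :
    polymerPartitionFunction (TTouch (d := 4) (N := N))
        (fun Z : TDom 4 N => t * (actSW D) N ((0 : B13HistM (PW D)) + (s : ℂ) • (wW D)) Z) {X₀ N} =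
      1 + t * (cexp ((s : ℂ) * (sW : ℂ)) - 1) := by
  rw [← Finset.insert_empty, polymerPartitionFunction_insert (fun _ _ h => ttouch_symm _ _ h) _ (Finset.notMem_empty _)]
  have hx : (actSW D) N ((0 : B13HistM (PW D)) + (s : ℂ) • (wW D)) (X₀ N) = cexp ((s : ℂ) * (sW : ℂ)) - 1 :=
    (actSW_pencil_closed D) N (s : ℂ)
  rw [zero_add] at hx
  simp [hx]

open Classical in
/-- **THE RAY IS ZERO-FREE** (indeed positive): `1 + t·(e^{s·sW} − 1) > 0` for `t ∈ [0, 1]` — a convex combination of `1` and `e^{s·sW}`. [folklore] -/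
theorem Z_ray_ne_zero (s : ℝ) : ∀ t ∈ Set.Icc (0 : ℝ) 1,
    polymerPartitionFunction (TTouch (d := 4) (N := N))
        (fun Z : TDom 4 N => (t : ℂ) * (actSW D) N ((0 : B13HistM (PW D)) + (s : ℂ) • (wW D)) Z) {X₀ N} ≠ 0 := by
  intro t ht h0
  rw [Z_cube_pencil, show (s : ℂ) * (sW : ℂ) = ((s * sW : ℝ) : ℂ) by push_cast; ring, ← Complex.ofReal_exp] at h0
  have h := congrArg Complex.re h0
  simp only [Complex.add_re, Complex.one_re, Complex.mul_re, Complex.ofReal_re, Complex.ofReal_im, Complex.sub_re, Complex.sub_im,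
    Complex.one_im, zero_mul, sub_zero, Complex.zero_re] at h
  have he := Real.exp_pos (s * sW)
  rcases eq_or_lt_of_le ht.2 with h1 | h1
  · rw [h1] at h; linarith
  · nlinarith [mul_nonneg ht.1 he.le]

/-! ## §25 CLOSED FORM: the dressed output at the cube along the real source pencil IS `s·sW` -/

open Classical in
/-- **THE ENDs' QUANTITY IN CLOSED FORM** [decided toy]: `E[actSW D N (0 + (s:ℂ) • wW D)]({0}) = s·sW` — W24's `locE_cube_eq` (the cube's
output is the Kotecký–Preiss logarithm of the singleton system), Literature `polymerLogZ_eq_log_of_real` (REAL activities on a zero-free ray: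
`log Z = Real.log (Re Z)`, §23∕§24), `Re Z = e^{s·sW}` (§24 at `t = 1`), `Real.log ∘ Real.exp = id`. [folklore] -/
theorem locE_pencil_real_closed (s : ℝ) :
    locE (Dom := (tsys 4 N).Dom) (TTouch (d := 4) (N := N)) (fun Z : (tsys 4 N).Dom => Z.1)
        ((actSW D) N ((0 : B13HistM (PW D)) + (s : ℂ) • (wW D))) (X₀ N).1 = ((s * sW : ℝ) : ℂ) := by
  have hce : locE (Dom := (tsys 4 N).Dom) (TTouch (d := 4) (N := N)) (fun Z : (tsys 4 N).Dom => Z.1)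
      ((actSW D) N ((0 : B13HistM (PW D)) + (s : ℂ) • (wW D))) (X₀ N).1 = _ :=
    locE_cube_eq N ((actSW D) N ((0 : B13HistM (PW D)) + (s : ℂ) • (wW D)))
  rw [hce]
  have hlog := (polymerLogZ_eq_log_of_real (inc := TTouch (d := 4) (N := N)) ((actSW_pencil_real D) N s) ((Z_ray_ne_zero D) N s)).2
  have hre : (polymerPartitionFunction (TTouch (d := 4) (N := N))
      (fun Z : TDom 4 N => (actSW D) N ((0 : B13HistM (PW D)) + (s : ℂ) • (wW D)) Z) {X₀ N}).re = Real.exp (s * sW) := by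
    have h1 := (Z_cube_pencil D) N s 1
    simp only [one_mul] at h1
    rw [h1, show (s : ℂ) * (sW : ℂ) = ((s * sW : ℝ) : ℂ) by push_cast; ring, ← Complex.ofReal_exp, add_sub_cancel, Complex.ofReal_re]
  rw [hre, Real.log_exp] at hlog
  convert hlog using 2

open Classical in
/-- The undressed output at the cube is `0` (§25 at `s = 0`: `(0:ℂ) • wW = 0`). [folklore] -/
theorem locE_undressed_zero :
    locE (Dom := (tsys 4 N).Dom) (TTouch (d := 4) (N := N)) (fun Z : (tsys 4 N).Dom => Z.1) ((actSW D) N (0 : B13HistM (PW D))) (X₀ N).1 = 0 := by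
  have h := (locE_pencil_real_closed D) N 0
  rwa [Complex.ofReal_zero, zero_smul, add_zero, zero_mul, Complex.ofReal_zero] at h

open Classical in
/-- **THE ATTACHED PART, EXACTLY**: `E[actSW (0 + wW)]({0}) − E[actSW 0]({0}) = sW` — the quantity W58 P2 §5 ∕ W73 (at `sμ = 1`) ∕ W80 bound. [folklore] -/
theorem attachedPart_exact :
    locE (Dom := (tsys 4 N).Dom) (TTouch (d := 4) (N := N)) (fun Z : (tsys 4 N).Dom => Z.1) ((actSW D) N ((0 : B13HistM (PW D)) + (wW D)))
        (X₀ N).1 -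
      locE (Dom := (tsys 4 N).Dom) (TTouch (d := 4) (N := N)) (fun Z : (tsys 4 N).Dom => Z.1) ((actSW D) N 0) (X₀ N).1 = (sW : ℂ) := by
  have h := (locE_pencil_real_closed D) N 1
  rw [Complex.ofReal_one, one_smul, one_mul] at h
  rw [h, locE_undressed_zero, sub_zero]

open Classical in
/-- … and in norm: `‖E[actSW (0 + wW)]({0}) − E[actSW 0]({0})‖ = sW`. [folklore] -/
theorem norm_attachedPart_exact :
    ‖locE (Dom := (tsys 4 N).Dom) (TTouch (d := 4) (N := N)) (fun Z : (tsys 4 N).Dom => Z.1) ((actSW D) N ((0 : B13HistM (PW D)) + (wW D)))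
          (X₀ N).1 -
        locE (Dom := (tsys 4 N).Dom) (TTouch (d := 4) (N := N)) (fun Z : (tsys 4 N).Dom => Z.1) ((actSW D) N 0) (X₀ N).1‖ = sW := by
  rw [attachedPart_exact, Complex.norm_real, Real.norm_eq_abs, abs_of_pos sW_pos]

open Classical in
/-- **THE μ-PART ALONG THE REAL SOURCE PENCIL, EXACTLY**: `E[actSW (0 + (t:ℂ) • wW)]({0}) − E[actSW 0]({0}) = t·sW` (W73's bounded quantity at
a real source value). [folklore] -/
theorem muPart_real_exact (t : ℝ) :
    locE (Dom := (tsys 4 N).Dom) (TTouch (d := 4) (N := N)) (fun Z : (tsys 4 N).Dom => Z.1)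
        ((actSW D) N ((0 : B13HistM (PW D)) + (t : ℂ) • (wW D))) (X₀ N).1 -
      locE (Dom := (tsys 4 N).Dom) (TTouch (d := 4) (N := N)) (fun Z : (tsys 4 N).Dom => Z.1) ((actSW D) N 0) (X₀ N).1 = ((t * sW : ℝ) : ℂ) := by
  rw [locE_pencil_real_closed, locE_undressed_zero, sub_zero]

/-! ## §26 LOCATED SLACK of OUR constants on OUR toy (an observation about the witnesses, not about print) -/

/-- `sW` IN CLOSED FORM: `sW = 1∕(2·rW) = A∕64 = (36864·e·K₀(64,8))⁻¹` (`rW = 32∕A`, W33's `A = (e·K₀(64,8)·9·64)⁻¹`). [folklore] -/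
theorem sW_closed : sW = (36864 * Real.exp 1 * K₀ 64 8)⁻¹ := by
  unfold sW rW Acst
  have hK := (K₀_pos (64 : ℝ) 8).ne'
  have he := (Real.exp_pos 1).ne'
  field_simp
  norm_num

/-- `K₀(64,8)` IN CLOSED FORM: `K₀(64,8) = e^{64·log 162}∕(8+1)² = 162⁶⁴∕81` (pv22's `kappa₀_four` BY NAME). [folklore] -/
theorem K₀_closed : K₀ (64 : ℝ) 8 = 162 ^ (64 : ℕ) / 81 := by
  have hκ : kappa₀ (64 : ℝ) 8 = 64 * Real.log 162 := by
    have h := kappa₀_four; norm_num at h; exact h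
  unfold K₀
  rw [hκ, show (64 : ℝ) * Real.log 162 = ((64 : ℕ) : ℝ) * Real.log 162 by norm_num, ← Real.log_pow,
    Real.exp_log (by positivity)]
  norm_num

/-- **THE ATTACHED-PART END IS NOT TIGHT ON THE TOY — BY THE FACTOR `73728·e·K₀(64,8)²`**: W58 P2 §5's closed bound `2·K₀(64,8)`
equals `(73728·e·K₀(64,8)²)·sW`, where `sW` is the EXACT value of the bounded quantity (`norm_attachedPart_exact`). [folklore] -/
theorem slack_attachedEnd : 2 * K₀ (64 : ℝ) 8 = (73728 * Real.exp 1 * K₀ 64 8 ^ 2) * sW := by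
  rw [sW_closed]
  have hK := (K₀_pos (64 : ℝ) 8).ne'
  have he := (Real.exp_pos 1).ne'
  field_simp
  ring

/-- … W73's μ-part END at `sμ = 1` (`slotLettersMuEnd_at_one`: `≤ K₀(64,8)`): factor `36864·e·K₀(64,8)²`. [folklore] -/
theorem slack_muEnd_at_one : K₀ (64 : ℝ) 8 = (36864 * Real.exp 1 * K₀ 64 8 ^ 2) * sW := by
  rw [sW_closed]
  have hK := (K₀_pos (64 : ℝ) 8).ne'
  have he := (Real.exp_pos 1).ne'
  field_simp

/-- … W80's ϱ-free sharp END (`slotLettersSharpEnd_fires_torus_closed`: `≤ 4∕3·K₀(64,8)`): factor `49152·e·K₀(64,8)²`. [folklore] -/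
theorem slack_sharpEnd : 4 / 3 * K₀ (64 : ℝ) 8 = (49152 * Real.exp 1 * K₀ 64 8 ^ 2) * sW := by
  rw [sW_closed]
  have hK := (K₀_pos (64 : ℝ) 8).ne'
  have he := (Real.exp_pos 1).ne'
  field_simp
  ring

open Classical in
/-- **THE END's BOUND HOLDS STRICTLY** on the toy: the exact value `sW ≤ 1∕64` is STRICTLY below W58 P2 §5's `2·K₀(64,8)` (`K₀(64,8) = 162⁶⁴∕81 > 1`).
[folklore] -/
theorem attachedEnd_not_tight :
    ‖locE (Dom := (tsys 4 N).Dom) (TTouch (d := 4) (N := N)) (fun Z : (tsys 4 N).Dom => Z.1) ((actSW D) N ((0 : B13HistM (PW D)) + (wW D)))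
          (X₀ N).1 -
        locE (Dom := (tsys 4 N).Dom) (TTouch (d := 4) (N := N)) (fun Z : (tsys 4 N).Dom => Z.1) ((actSW D) N 0) (X₀ N).1‖ < 2 * K₀ 64 8 := by
  rw [norm_attachedPart_exact, K₀_closed]
  have h := sW_le
  have h2 : (1 : ℝ) / 64 < 2 * (162 ^ (64 : ℕ) / 81) := by norm_num
  linarith

end Summit.QuantumFields.BalabanUV.T4Continuum.NE1p.DressedSmallFieldSlotLettersWitnessExact
end
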